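import Literature.IUT.HodgeTheaters.PiAvatarNegCompatGood
import Mathlib.CategoryTheory.ObjectProperty.FullSubcategory
import HarnessLib

/-!
# The Π-avatar BINDING of [IUTchI] Def 6.1 (ii)/(v), Ex 6.3 (i) at the genuine initial Θ-data: the objects `𝒟^{⊚±}`,
# `𝒟^⊚`, `𝒟_v̲` (good `v̲`) and the morphism `φ^{Θell}_{•,v̲}` as data of ONE orbit category (KIT-INSTANCE-SPEC P5-binding,
# first definitions; post-freeze additive class of L5-lead RULINGS #30 (2))

S. Mochizuki, *Inter-universal Teichmüller theory I*, kurims manuscript (May 2020), Def 3.1 (d)(e)(f) pp. 62–63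
(`X̲_K → X_K`, `C̲_K → C_K`; base change to `K_v̲`; "`Π_v̲ := Π_{X̲→_v̲}`" for `v̲ ∈ V̲^good`), Def 4.1 (v) p. 97
(`𝒟^⊚ := ℬ(C̲_K)⁰`), Example 3.3 (i) p. 77 (`𝒟_v := ℬ(X̲→_v̲)⁰`), Def 6.1 (v) p. 158 (`𝒟^{⊚±} := ℬ(X̲_K)⁰`, "any category
isomorphic to `𝒟^{⊚±}`", Def 6.1 (vi) p. 159), Example 6.3 (i) p. 161 ("the natural composite morphism `X̲→_v → X_v → X_K`
… determines a natural morphism `φ^{Θell}_{•,v} : 𝒟_v → 𝒟^{⊚±}`") ([IUTchI] Def 6.1 (v) p.158) [claim: Mochizuki2012, status: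
disputed] (D-0012 claim key, series status DISPUTED — DEFINITIONS over abc-iut-L5-t2's REAL `InitialThetaData` in
abc-iut-L5-t4's orbit category (design D1 = EMBEDDED, L5-lead RULINGS #17 (2)); nothing of the series is asserted, no side
is taken on [IUTchIII] Cor. 3.12).

WHAT IS DEFINED (the slots `Glob`, `gModel`, `gIso`, `Amb v`, `model v`, `atV v`, `phiEll v` of abc-iut-L5-t4's `PMBaseKit`
for the GLOBAL object and the GOOD places; the label slots wait on GAP G-L5t4g3-1, the bad places on G-L5t4g3-2 (iii)):
* `InitialThetaData.PiAmbient D := OrbitCat D.PiC` — ONE ambient category `Amb v` for every `v̲` AND the home of the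
  global objects (so `atV v` is the identity functor);
* `gModelObj D := ℬ(X̲_K)⁰` (`OrbitCat.of D.PiXund`) = `𝒟^{⊚±}`; `gBaseObj D := ℬ(C̲_K)⁰` = `𝒟^⊚`; `globCover D : 𝒟^{⊚±} ⟶ 𝒟^⊚`;
* `IsGlobIsomorph D : ObjectProperty` ("any category isomorphic to `𝒟^{⊚±}`"), `Glob D` := Mathlib's full subcategory on
  it (NO instance declared here), `gModel D : D.Glob`, `gIso` PROVED, `isGlobIsomorph_iff_conjugate` (the isomorphs are
  the conjugates `ℬ(aΠ_{X̲_K}a⁻¹)⁰`);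
* `locModelObj D Gv := ℬ(Π_{X̲→_K} ∩ augGF⁻¹ Gv)⁰` = `𝒟_v̲` for a decomposition group `Gv = G_v̲` (good `v̲`; Def 3.1 (e)(f) base
  change, abc-iut-L5-t2's `range_fstLoc` shape), `IsLocIsomorph`;
* `phiEllAt D Gv : 𝒟_v̲ ⟶ 𝒟^{⊚±}` = `φ^{Θell}_{•,v̲}` (the inclusion `Π_{X̲→_v̲} ≤ Π_{X̲_K}` read as `xΠ_v̲ ↦ xΠ_{X̲_K}`),
  `fn_phiEllAt`;
* restatements on the bound objects: `exists_involution_gModel` (Def 6.1 (v) `±`), `exists_negCompat_phiEllAt` (Ex 6.3 (ii)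
  negative square, conditional on abc-iut-L5-t1's typed §1 claims `hA`).
typed ≠ proved elsewhere; no instance/notation declared.
-/

namespace Literature.IUT.HodgeTheaters

open CategoryTheory

universe u v w

section Binding

variable {F : Type u} {K : Type v} {Fbar : Type w} [Field F] [NumberField F] [Field K]
  [NumberField K] [Algebra F K] [Field Fbar] [Algebra F Fbar] [Algebra K Fbar]
  {E : WeierstrassCurve F} [E.IsElliptic] {l : ℕ} {P : BadPlacePredicates K}
  (D : InitialThetaData F K Fbar E l P)

namespace InitialThetaData

/-! ### The ambient (Def 4.1 (i) / 6.1 (ii): one orbit category for everything) -/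

/-- **The Π-avatar ambient category of the initial Θ-data**: the orbit category of `Π_{C_F}` (objects `ℬ(H)⁰` for
`H ≤ Π_{C_F}`, morphisms over the ambient). It serves as `Amb v` for every `v̲` and as the home of `𝒟^{⊚±}`, `𝒟^⊚`
(design D1 EMBEDDED). ([IUTchI] Def 4.1 (i) p.95) [claim: Mochizuki2012, status: disputed] -/
abbrev PiAmbient : Type w := OrbitCat D.PiC

/-! ### The global objects `𝒟^{⊚±} → 𝒟^⊚` (Def 6.1 (v), Def 4.1 (v)) -/

/-- **`𝒟^{⊚±} := ℬ(X̲_K)⁰`** (Def 6.1 (v) p.158), the embedded object of `Π_{X̲_K} = D.PiXund`.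
([IUTchI] Def 6.1 (v) p.158) [claim: Mochizuki2012, status: disputed] -/
abbrev gModelObj : D.PiAmbient := OrbitCat.of D.PiXund

/-- **`𝒟^⊚ := ℬ(C̲_K)⁰`** (Def 4.1 (v) p.97), the embedded object of `Π_{C̲_K} = D.PiCund`.
([IUTchI] Def 4.1 (v) p.97) [claim: Mochizuki2012, status: disputed] -/
abbrev gBaseObj : D.PiAmbient := OrbitCat.of D.PiCund

/-- `sub` of `𝒟^{⊚±}` is `Π_{X̲_K}`. ([IUTchI] Def 6.1 (v) p.158) [claim: Mochizuki2012, status: disputed] -/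
@[simp] theorem sub_gModelObj : (D.gModelObj).sub = D.PiXund := rfl

/-- `sub` of `𝒟^⊚` is `Π_{C̲_K}`. ([IUTchI] Def 4.1 (v) p.97) [claim: Mochizuki2012, status: disputed] -/
@[simp] theorem sub_gBaseObj : (D.gBaseObj).sub = D.PiCund := rfl

/-- **The finite étale double covering `𝒟^{⊚±} → 𝒟^⊚`** (Def 6.1 (v) p.158): `xΠ_{X̲_K} ↦ xΠ_{C̲_K}`.
([IUTchI] Def 6.1 (v) p.158) [claim: Mochizuki2012, status: disputed] -/
def globCover : D.gModelObj ⟶ D.gBaseObj :=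
  OrbitCat.homOfElem 1 (OrbitCat.one_conj_mem_of_le D.PiXund_le_PiCund)

/-- The covering map is `xΠ_{X̲_K} ↦ xΠ_{C̲_K}`. ([IUTchI] Def 6.1 (v) p.158) [claim: Mochizuki2012, status: disputed] -/
@[simp] theorem fn_globCover (x : D.PiC) :
    OrbitCat.fn D.globCover (QuotientGroup.mk x) = QuotientGroup.mk x := by
  change OrbitCat.fn (OrbitCat.homOfElem (H := D.PiXund) (K := D.PiCund) (1 : D.PiC) _)
      (QuotientGroup.mk x) = QuotientGroup.mk x
  rw [OrbitCat.fn_homOfElem, mul_one]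

/-- **Isomorphs of `𝒟^{⊚±}`** ("`†𝒟^{⊚±}` … any category isomorphic to `𝒟^{⊚±}`", Def 6.1 (v)/(vi) pp.158–159): the
object property of being isomorphic, in the ambient, to `𝒟^{⊚±}`. ([IUTchI] Def 6.1 (v) p.158) [claim: Mochizuki2012, status: disputed] -/
def IsGlobIsomorph : ObjectProperty D.PiAmbient := fun X => Nonempty (X ≅ D.gModelObj)

/-- The isomorphs of `𝒟^{⊚±}` are exactly the embedded objects of the CONJUGATES of `Π_{X̲_K}`.
([IUTchI] Def 6.1 (v) p.158) [claim: Mochizuki2012, status: disputed] -/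
theorem isGlobIsomorph_iff_conjugate (H : Subgroup D.PiC) :
    D.IsGlobIsomorph (OrbitCat.of H) ↔ ∃ a : D.PiC, ∀ x, x ∈ D.PiXund ↔ a * x * a⁻¹ ∈ H :=
  OrbitCat.nonempty_iso_iff_conjugate H D.PiXund

/-- **`Glob` — the category of isomorphs `†𝒟^{⊚±}` of `𝒟^{⊚±}` and their morphisms** (the kit slot `PMBaseKit.Glob`):
Mathlib's full subcategory of the ambient on `IsGlobIsomorph` (category structure = Mathlib's; no instance declared
here). ([IUTchI] Def 6.1 (v) p.158) [claim: Mochizuki2012, status: disputed] -/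
abbrev Glob : Type w := (D.IsGlobIsomorph).FullSubcategory

/-- `𝒟^{⊚±}` as an object of `Glob` (the kit slot `gModel`). ([IUTchI] Def 6.1 (v) p.158) [claim: Mochizuki2012, status: disputed] -/
def gModel : D.Glob := ⟨D.gModelObj, ⟨Iso.refl _⟩⟩

/-- The underlying ambient object of `gModel` is `𝒟^{⊚±}`. ([IUTchI] Def 6.1 (v) p.158) [claim: Mochizuki2012, status: disputed] -/
@[simp] theorem gModel_obj : (D.gModel).obj = D.gModelObj := rfl

/-- **Every object of `Glob` is an isomorph of `𝒟^{⊚±}`** (the kit LAW `gIso`, here a theorem by construction).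
([IUTchI] Def 6.1 (v) p.158) [claim: Mochizuki2012, status: disputed] -/
theorem gIso (G : D.Glob) : Nonempty (G ≅ D.gModel) :=
  ⟨(D.IsGlobIsomorph).isoMk G.property.some⟩

/-! ### The local objects at good places and `φ^{Θell}_{•,v̲}` (Def 3.1 (e)(f), Ex 3.3 (i), Ex 6.3 (i)) -/

/-- **`𝒟_v̲ := ℬ(Π_v̲)⁰`, `Π_v̲ := Π_{X̲→_v̲} = Π_{X̲→_K} ∩ augGF⁻¹(G_v̲)`** for a decomposition group `Gv = G_v̲ ≤ G_F` (good `v̲`: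
Def 3.1 (f) "`Π_v̲ := Π_{X̲→_v̲}`", Ex 3.3 (i) "`𝒟_v := ℬ(X̲→_v̲)⁰`"; the base change of Def 3.1 (e) read as a subgroup of
`Π_{C_F}`, abc-iut-L5-t2's `range_fstLoc`). The kit slot `model v`. ([IUTchI] Ex 3.3 (i) p.77) [claim: Mochizuki2012, status: disputed] -/
abbrev locModelObj (Gv : Subgroup (Fbar ≃ₐ[F] Fbar)) : D.PiAmbient :=
  OrbitCat.of (D.PiXarrow ⊓ Gv.comap D.augGF)

/-- `sub` of `𝒟_v̲` is `Π_{X̲→_K} ∩ augGF⁻¹(G_v̲)`. ([IUTchI] Ex 3.3 (i) p.77) [claim: Mochizuki2012, status: disputed] -/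
@[simp] theorem sub_locModelObj (Gv : Subgroup (Fbar ≃ₐ[F] Fbar)) :
    (D.locModelObj Gv).sub = D.PiXarrow ⊓ Gv.comap D.augGF := rfl

/-- `Π_v̲ ≤ Π_{X̲_K}`. ([IUTchI] Def 3.1 (f) p.63) [claim: Mochizuki2012, status: disputed] -/
theorem sub_locModelObj_le_PiXund (Gv : Subgroup (Fbar ≃ₐ[F] Fbar)) :
    D.PiXarrow ⊓ Gv.comap D.augGF ≤ D.PiXund :=
  inf_le_left.trans D.PiXarrow_le_PiXund

/-- Isomorphs `†𝒟_v̲` of `𝒟_v̲` (Def 4.1 (i) "a category which admits an equivalence `†𝒟_v ⥲ 𝒟_v`"): the kit predicate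
`IsLocal v`, in the ambient. ([IUTchI] Def 4.1 (i) p.95) [claim: Mochizuki2012, status: disputed] -/
def IsLocIsomorph (Gv : Subgroup (Fbar ≃ₐ[F] Fbar)) : ObjectProperty D.PiAmbient :=
  fun X => Nonempty (X ≅ D.locModelObj Gv)

/-- The isomorphs of `𝒟_v̲` are the embedded objects of the conjugates of `Π_v̲`.
([IUTchI] Def 4.1 (i) p.95) [claim: Mochizuki2012, status: disputed] -/
theorem isLocIsomorph_iff_conjugate (Gv : Subgroup (Fbar ≃ₐ[F] Fbar)) (H : Subgroup D.PiC) :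
    D.IsLocIsomorph Gv (OrbitCat.of H) ↔
      ∃ a : D.PiC, ∀ x, x ∈ D.PiXarrow ⊓ Gv.comap D.augGF ↔ a * x * a⁻¹ ∈ H :=
  OrbitCat.nonempty_iso_iff_conjugate H _

/-- **`φ^{Θell}_{•,v̲} : 𝒟_v̲ → 𝒟^{⊚±}`** (Ex 6.3 (i) p.161: "determined by the natural composite morphism
`X̲→_v → X_v → X_K`"): in the Π-avatar, the morphism `xΠ_v̲ ↦ xΠ_{X̲_K}` induced by `Π_v̲ ≤ Π_{X̲_K}`. The kit slot `phiEll v`.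
([IUTchI] Ex 6.3 (i) p.161) [claim: Mochizuki2012, status: disputed] -/
def phiEllAt (Gv : Subgroup (Fbar ≃ₐ[F] Fbar)) : D.locModelObj Gv ⟶ D.gModelObj :=
  OrbitCat.homOfElem 1 (OrbitCat.one_conj_mem_of_le (D.sub_locModelObj_le_PiXund Gv))

/-- `φ^{Θell}_{•,v̲}` is `xΠ_v̲ ↦ xΠ_{X̲_K}`. ([IUTchI] Ex 6.3 (i) p.161) [claim: Mochizuki2012, status: disputed] -/
@[simp] theorem fn_phiEllAt (Gv : Subgroup (Fbar ≃ₐ[F] Fbar)) (x : D.PiC) :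
    OrbitCat.fn (D.phiEllAt Gv) (QuotientGroup.mk x) = QuotientGroup.mk x := by
  change OrbitCat.fn (OrbitCat.homOfElem (H := D.PiXarrow ⊓ Gv.comap D.augGF) (K := D.PiXund) (1 : D.PiC) _)
      (QuotientGroup.mk x) = QuotientGroup.mk x
  rw [OrbitCat.fn_homOfElem, mul_one]

/-! ### What is already a theorem on the bound objects -/

/-- **Def 6.1 (v) at the bound global object**: `𝒟^{⊚±}` has a non-trivial involutive automorphism (the `±` of the
double covering `𝒟^{⊚±} → 𝒟^⊚`; abc-iut-L5-t4 `exists_globalInvolution`). ([IUTchI] Def 6.1 (v) p.158) [claim: Mochizuki2012, status: disputed] -/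
theorem exists_involution_gModelObj :
    ∃ e : D.gModelObj ≅ D.gModelObj, e ≠ Iso.refl _ ∧ e ≪≫ e = Iso.refl _ ∧ e.hom ≫ D.globCover = D.globCover := by
  obtain ⟨a, ha, haC, haX, hne, hsq⟩ := D.exists_globalInvolution
  refine ⟨OrbitCat.autOfNormalizer a ha, hne, hsq, ?_⟩
  -- `xΠ_{X̲_K} ↦ xaΠ_{X̲_K} ↦ xaΠ_{C̲_K} = xΠ_{C̲_K}` since `a ∈ Π_{C̲_K}`
  apply OrbitCat.hom_ext_fn
  funext q
  induction q using Quotient.inductionOn' with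
  | h x =>
    change OrbitCat.fn D.globCover (OrbitCat.fn (OrbitCat.autOfNormalizer a ha).hom (QuotientGroup.mk x)) =
      OrbitCat.fn D.globCover (QuotientGroup.mk x)
    rw [OrbitCat.fn_autOfNormalizer_hom, D.fn_globCover, D.fn_globCover, QuotientGroup.eq]
    simpa [mul_inv_rev, mul_assoc] using D.PiCund.inv_mem haC

/-- **Ex 6.3 (ii), negative case, on the bound objects (good `v̲`)**: one automorphism `a` of `𝒟_v̲` (non-trivial,
involutive) and one automorphism `b` of `𝒟^{⊚±}` (THE non-trivial involution) with `a ≫ φ^{Θell}_{•,v̲} = φ^{Θell}_{•,v̲} ≫ b`,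
conditional on abc-iut-L5-t1's typed §1 claims `hA` (abc-iut-L5-t4 `exists_negCompat_good`).
([IUTchI] Ex 6.3 (ii) p.161) [claim: Mochizuki2012, status: disputed] -/
theorem exists_negCompat_phiEllAt (hA : D.geom.pe.ArrowCoveringClaims) (Gv : Subgroup (Fbar ≃ₐ[F] Fbar)) :
    ∃ (a : D.locModelObj Gv ≅ D.locModelObj Gv) (b : D.gModelObj ≅ D.gModelObj),
      a ≠ Iso.refl _ ∧ a ≪≫ a = Iso.refl _ ∧ b ≠ Iso.refl _ ∧ b ≪≫ b = Iso.refl _ ∧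
        a.hom ≫ D.phiEllAt Gv = D.phiEllAt Gv ≫ b.hom := by
  obtain ⟨c, hcv, hcK, ha1, ha2, hb1, hb2, hsq⟩ := D.exists_negCompat_good hA Gv
  exact ⟨OrbitCat.autOfNormalizer c hcv, OrbitCat.autOfNormalizer c hcK, ha1, ha2, hb1, hb2, hsq⟩

end InitialThetaData

end Binding

end Literature.IUT.HodgeTheaters
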